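import Literature.Analysis.FluidPDE.ConstantinFeffermanEnstrophySlab
import HarnessLib

/-!
# CriticalCoherenceDoorGronwallTools — door S33 «CriticalCoherenceDoor», tools for plate G33 «PowerGronwallSlab»

S-door lane helper (ns-s29-p2 g4; LEAD ns-s30-p1 g2's plate map 2026-08-28T13:14:22Z; texts of record
nsreg-p1 g27 `r31/Sketch33.lean` sha16 ae52fe0f17f630b4), `--supports stmt-NavierStokesRegularity-0056 --as helper`.
Two self-contained lemmas used by `Theorems/CriticalCoherenceDoorGronwall.lean`
(`powerGronwallSlab_holds : PowerGronwallSlab`):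

* `lintegral_enorm_sq_le_of_vorticity_eq` — fixed time: the `L²` size of the vorticity's time derivative
  `w = νΔω + (ω·∇)v − (v·∇)ω` in terms of `∫⁻‖Dv‖ₑ², ∫⁻‖D²v‖ₑ², ∫⁻‖D³v‖ₑ²` and sup bounds on `v, ∇v`
  (the pointwise step of the tree's `integral_sq_norm_curl_le_of_direction_slab`, isolated);
* `lintegral_Ioo_div_sub_eq` — the logarithmic integral of G33's singular coefficient:
  `∫_{(0,t)} a/(T − s) ds = a·log(T/(T − t))` for `0 ≤ a`, `0 ≤ t < T` (substitution `s ↦ T − s`,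
  Mathlib's `integral_inv_of_pos`).

WHAT THIS IS NOT: calculus helpers for one plate of a regularity CRITERION about hypothetical blow-up;
item 0056 `NoTypeII` and NS regularity are NOT proved; no Literature fact is taken as a hypothesis.
-/

noncomputable section

open MeasureTheory Set Function Filter Metric Real InnerProductSpace
open _root_.Topology
open scoped ENNReal NNReal RealInnerProductSpace ContDiff Laplacian
open Literature.Analysis.FluidPDE

set_option linter.dupNamespace false

namespace Summit.NavierStokesRegularity.NavierStokesRegularity.Theorems.CriticalCoherenceDoor

-- nested operator types (second and third derivatives)
set_option maxSynthPendingDepth 3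

/-- support (fixed time; the `L²` size of the vorticity's time derivative). Let `v ∈ C³(ℝ³; ℝ³)` with
`‖v‖ ≤ B₀`, `‖∇v‖ ≤ B₁` (`B₀, B₁ ≥ 0`), `ν > 0`, and let `w` satisfy the vorticity equation pointwise,
`w + (v·∇)ω = (ω·∇)v + νΔω` (`ω = curl v`). Then, with `κ = ‖curlCLM‖`,
`∫⁻‖w‖ₑ² ≤ 3((3νκ)² ∫⁻‖D³v‖ₑ² + (B₀κ)² ∫⁻‖D²v‖ₑ² + (B₁κ)² ∫⁻‖Dv‖ₑ²)` — the pointwise bound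
`‖w‖ ≤ 3νκ‖D³v‖ + B₀κ‖D²v‖ + B₁κ‖Dv‖` (`norm_laplacian_le_three_mul_norm_iteratedFDeriv_two`,
`norm_iteratedFDeriv_curl_le_opNorm_mul`) and `lintegral_enorm_sq_le_of_norm_le_three`. -/
theorem lintegral_enorm_sq_le_of_vorticity_eq {ν B₀ B₁ : ℝ} (hν : 0 < ν) (hB₀0 : 0 ≤ B₀)
    (hB₁0 : 0 ≤ B₁) {v w : (EuclideanSpace ℝ (Fin 3)) → (EuclideanSpace ℝ (Fin 3))}
    (hv : ContDiff ℝ 3 v) (hB₀ : ∀ x, ‖v x‖ ≤ B₀) (hB₁ : ∀ x, ‖fderiv ℝ v x‖ ≤ B₁)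
    (hw : ∀ x, w x + convect v (curl v) x = convect (curl v) v x + ν • (Δ (curl v)) x) :
    ∫⁻ x, ‖w x‖ₑ ^ 2 ≤ 3 * (ENNReal.ofReal ((ν * (3 * ‖curlCLM‖)) ^ 2) *
        (∫⁻ x, ‖iteratedFDeriv ℝ 3 v x‖ₑ ^ 2) +
      ENNReal.ofReal ((B₀ * ‖curlCLM‖) ^ 2) * (∫⁻ x, ‖iteratedFDeriv ℝ 2 v x‖ₑ ^ 2) +
      ENNReal.ofReal ((B₁ * ‖curlCLM‖) ^ 2) * (∫⁻ x, ‖iteratedFDeriv ℝ 1 v x‖ₑ ^ 2)) := by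
  set κ : ℝ := ‖curlCLM‖ with hκ
  have hpt : ∀ x, ‖w x‖ ≤ (ν * (3 * κ)) * ‖iteratedFDeriv ℝ 3 v x‖ +
      (B₀ * κ) * ‖iteratedFDeriv ℝ 2 v x‖ + (B₁ * κ) * ‖iteratedFDeriv ℝ 1 v x‖ := by
    intro x
    have hw2 : ContDiff ℝ 2 (curl v) := contDiff_curl (n := 2) (by exact hv)
    have heq : w x = ν • (Δ (curl v)) x - convect v (curl v) x + convect (curl v) v x := by
      have : w x = convect (curl v) v x + ν • (Δ (curl v)) x - convect v (curl v) x :=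
        eq_sub_of_add_eq (hw x)
      rw [this]; abel
    rw [heq]
    have t1 : ‖ν • (Δ (curl v)) x‖ ≤ (ν * (3 * κ)) * ‖iteratedFDeriv ℝ 3 v x‖ := by
      rw [norm_smul, Real.norm_of_nonneg hν.le, mul_assoc, mul_assoc]
      refine mul_le_mul_of_nonneg_left ?_ hν.le
      calc ‖(Δ (curl v)) x‖ ≤ 3 * ‖iteratedFDeriv ℝ 2 (curl v) x‖ :=
            norm_laplacian_le_three_mul_norm_iteratedFDeriv_two hw2 x
        _ ≤ 3 * (κ * ‖iteratedFDeriv ℝ 3 v x‖) :=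
            mul_le_mul_of_nonneg_left
              (norm_iteratedFDeriv_curl_le_opNorm_mul hv 2 (by norm_num) x) (by norm_num)
    have t2 : ‖convect v (curl v) x‖ ≤ (B₀ * κ) * ‖iteratedFDeriv ℝ 2 v x‖ := by
      rw [convect]
      calc ‖fderiv ℝ (curl v) x (v x)‖ ≤ ‖fderiv ℝ (curl v) x‖ * ‖v x‖ :=
            ContinuousLinearMap.le_opNorm _ _
        _ ≤ (κ * ‖iteratedFDeriv ℝ 2 v x‖) * B₀ := by
            refine mul_le_mul ?_ (hB₀ x) (norm_nonneg _) (by positivity)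
            rw [← norm_iteratedFDeriv_one]
            exact norm_iteratedFDeriv_curl_le_opNorm_mul hv 1 (by norm_num) x
        _ = (B₀ * κ) * ‖iteratedFDeriv ℝ 2 v x‖ := by ring
    have t3 : ‖convect (curl v) v x‖ ≤ (B₁ * κ) * ‖iteratedFDeriv ℝ 1 v x‖ := by
      rw [convect]
      calc ‖fderiv ℝ v x (curl v x)‖ ≤ ‖fderiv ℝ v x‖ * ‖curl v x‖ :=
            ContinuousLinearMap.le_opNorm _ _
        _ ≤ B₁ * (κ * ‖iteratedFDeriv ℝ 1 v x‖) := by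
            refine mul_le_mul (hB₁ x) ?_ (norm_nonneg _) hB₁0
            have h := norm_iteratedFDeriv_curl_le_opNorm_mul hv 0 (by norm_num) x
            rwa [norm_iteratedFDeriv_zero] at h
        _ = (B₁ * κ) * ‖iteratedFDeriv ℝ 1 v x‖ := by ring
    have e1 : ‖ν • (Δ (curl v)) x - convect v (curl v) x + convect (curl v) v x‖ ≤
        ‖ν • (Δ (curl v)) x - convect v (curl v) x‖ + ‖convect (curl v) v x‖ :=
      norm_add_le _ _
    have e2 : ‖ν • (Δ (curl v)) x - convect v (curl v) x‖ ≤
        ‖ν • (Δ (curl v)) x‖ + ‖convect v (curl v) x‖ := norm_sub_le _ _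
    linarith [e1, e2, t1, t2, t3]
  exact lintegral_enorm_sq_le_of_norm_le_three (hv.continuous_iteratedFDeriv le_rfl)
    (hv.continuous_iteratedFDeriv (by norm_num)) (hv.continuous_iteratedFDeriv (by norm_num))
    (by positivity) (by positivity) (by positivity) hpt

/-- support (the logarithmic integral of the singular coefficient): for `0 ≤ a` and `0 ≤ t < T`,
`∫_{(0,t)} a/(T − s) ds = a·log(T/(T − t))`, in lower-integral form (substitution `s ↦ T − s` and
Mathlib's `integral_inv_of_pos`). -/
theorem lintegral_Ioo_div_sub_eq {T t a : ℝ} (ha : 0 ≤ a) (ht0 : 0 ≤ t) (htT : t < T) :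
    ∫⁻ s in Ioo 0 t, ENNReal.ofReal (a / (T - s)) =
      ENNReal.ofReal (a * Real.log (T / (T - t))) := by
  have hT : 0 < T := lt_of_le_of_lt ht0 htT
  have hcont : ContinuousOn (fun s : ℝ => a / (T - s)) (Icc 0 t) :=
    continuousOn_const.div (continuousOn_const.sub continuousOn_id) fun s hs =>
      (sub_pos.2 (hs.2.trans_lt htT)).ne'
  have hint : IntegrableOn (fun s : ℝ => a / (T - s)) (Ioo 0 t) :=
    hcont.integrableOn_Icc.mono_set Ioo_subset_Icc_self
  have hnn : 0 ≤ᵐ[volume.restrict (Ioo 0 t)] fun s : ℝ => a / (T - s) := by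
    refine ae_restrict_of_forall_mem measurableSet_Ioo fun s hs => ?_
    exact div_nonneg ha (sub_pos.2 (hs.2.trans htT)).le
  rw [← ofReal_integral_eq_lintegral_ofReal hint hnn]
  congr 1
  have h3 : ∫ s in (0 : ℝ)..t, a / (T - s) = ∫ s in Ioo 0 t, a / (T - s) := by
    rw [intervalIntegral.integral_of_le ht0, integral_Ioc_eq_integral_Ioo]
  rw [← h3]
  have h1 : ∫ s in (0 : ℝ)..t, a / (T - s) = a * ∫ s in (0 : ℝ)..t, (T - s)⁻¹ := by
    rw [← intervalIntegral.integral_const_mul]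
    refine intervalIntegral.integral_congr fun s _ => ?_
    simp only [div_eq_mul_inv]
  rw [h1]
  congr 1
  have h2 : ∫ s in (0 : ℝ)..t, (T - s)⁻¹ = ∫ x in T - t..T - 0, x⁻¹ :=
    intervalIntegral.integral_comp_sub_left (fun x : ℝ => x⁻¹) T
  rw [h2, sub_zero, integral_inv_of_pos (sub_pos.2 htT) hT]

end Summit.NavierStokesRegularity.NavierStokesRegularity.Theorems.CriticalCoherenceDoor

end
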